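import Summits.ValiantsHypothesis.ValiantsHypothesis.Theorems.LacunarySymmetroidMatrixDescartesCensusEnvelopeBudgetCard

/-!
# `MatrixDescartes` census — PAIR BUDGET kit: the orthogonal pair `(u, u⊥)`, the discrete sweep lemma, bilinear flips (part 1 of 2)

HONEST FRAMING.  Object-search cell `pub-symmetroid`, door-A item `Theses.LacunarySymmetroid.DoorA26 = PosRootLawAt 2 6 19`
(stmt-ValiantsHypothesis-19979; OPEN, typed, never asserted).  Located NECESSARY CONDITIONS on a hypothetical twenty (a real symmetric
`2 × 2` six-term pencil `F(x) = ∑ x^{d_l} S_l` with `20` distinct positive det-roots), valid for EVERY support; nothing here bounds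
`ζ_sym(2,6)`.  Companion of the envelope layer (`…CensusEnvelopeToolkit/Setup/Budget/BudgetCard`, door-p1 g0); part 2 is
`…CensusPairBudget` (the budget `#Φ + #G_u ≤ 5`).

THE (1,2)-SPECIFIC INGREDIENT.  For a direction `u = (p,q)` put `u⊥ = (−q,p)`, `f_u(x) = uᵀF(x)u`, `f_⊥(x) = u⊥ᵀF(x)u⊥` and the
MIXED FORM `g_u(x) = u⊥ᵀF(x)u` — three six-nomials in `x` (each `< 6` positive roots unless identically zero).  In the orthogonal
pair `(u,u⊥)` the determinant reads `f_u·f_⊥ − g_u² = |u|⁴·det F` (`quadForm_mul_perp_sub_mixed_sq`).  Hence: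
* at a det-ROOT, `f_u·f_⊥ = g_u² ≥ 0` (rank one);
* at an INDEFINITE point where the mixed form vanishes, `f_u·f_⊥ < 0`: one of the two orthogonal directions is strictly negative and the
  other strictly positive («DISCRETE SWEEP LEMMA», `quadForm_mul_perp_neg_of_mixed_eq_zero`).  `g_u(x) = 0` says `u` is an EIGENVECTOR of
  `F(x)` (`mulVec_eq_quadForm_smul_add_mixed_smul`); the lemma is the root-side trace of the fact that the eigenframe of a REAL symmetric
  `2 × 2` matrix lives on the circle `ℝP¹`, so that between two positions it must pass every intermediate direction.  It is FALSE for
  complex-Hermitian letters (there the mixed form is complex and its vanishing is two real conditions) — and complex-Hermitian `2 × 2`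
  six-term pencils DO reach `20` (theory-3 g18, exact objects on `(0,2,3,7,15,26)`); so this is an ingredient «separating real rank 3
  from Hermitian rank 4» on the root side.
ALSO HERE: `card_bilinFlips_le_five_of_twenty` — for ANY two vectors `v,u`, the bilinear value `vᵀF(r_k)u` changes sign at most `5`
times along the 20 sorted roots (in particular the mixed form: the kernel/eigen-directions at the roots, read through the quadrant test of
any orthogonal cross `(u,u⊥)` and twisted by the types, flip at most `5` times — the EIGENFRAME BUDGET); and the counting lemma
`card_add_two_mul_card_le_card_posRoots` used by part 2.  What is NOT here: magnitudes; nothing about `DoorA26` on all supports, the crux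
`MatrixDescartes` (stmt-ValiantsHypothesis-18050) or `VP ≠ VNP`.

[folklore] Elementary linear algebra of real symmetric `2 × 2` matrices, the intermediate value theorem, and the tree's sparse
Descartes bound for six-nomials; no single source.
-/

-- `Summit.ValiantsHypothesis.ValiantsHypothesis.…` repeats a component by the D-0017 layout
-- (single-conjunct summit), which the `dupNamespace` linter flags; the name is mandated.
set_option linter.dupNamespace false

namespace Summit.ValiantsHypothesis.ValiantsHypothesis.Theorems.LacunarySymmetroidMatrixDescartes.Census

open Polynomial Finset
open scoped BigOperators Polynomial Matrix
open Summit.ValiantsHypothesis.ValiantsHypothesis.Theorems.SymmetroidDescartes (eval_det_pencil)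


/-! ### The orthogonal pair `(u, u⊥)` on a real symmetric `2 × 2` matrix -/

/-- Explicit form of a quadratic/bilinear value `v ⬝ᵥ (M *ᵥ u)` on `Fin 2`. [folklore] -/
theorem dotProduct_mulVec_fin_two (M : Matrix (Fin 2) (Fin 2) ℝ) (v u : Fin 2 → ℝ) :
    v ⬝ᵥ (M *ᵥ u) = v 0 * (M 0 0 * u 0 + M 0 1 * u 1) + v 1 * (M 1 0 * u 0 + M 1 1 * u 1) := by
  simp only [Matrix.mulVec, dotProduct, Fin.sum_univ_two]

/-- **The determinant in an orthogonal pair.**  For a real symmetric `2 × 2` matrix `M` and any `u`: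
`(uᵀMu)·(u⊥ᵀMu⊥) − (u⊥ᵀMu)² = |u|⁴ · det M`. [folklore] -/
theorem quadForm_mul_perp_sub_mixed_sq (M : Matrix (Fin 2) (Fin 2) ℝ) (hM : M.IsSymm) (u : Fin 2 → ℝ) :
    (u ⬝ᵥ (M *ᵥ u)) * (![-u 1, u 0] ⬝ᵥ (M *ᵥ ![-u 1, u 0])) - (![-u 1, u 0] ⬝ᵥ (M *ᵥ u)) ^ 2 = (u ⬝ᵥ u) ^ 2 * M.det := by
  have hs : M 1 0 = M 0 1 := by
    have h := congrFun (congrFun hM 0) 1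
    simpa [Matrix.transpose_apply] using h
  rw [dotProduct_mulVec_fin_two, dotProduct_mulVec_fin_two, dotProduct_mulVec_fin_two, Matrix.det_fin_two, hs]
  simp only [dotProduct, Fin.sum_univ_two, Matrix.cons_val_zero, Matrix.cons_val_one]
  ring

/-- At a singular point (`det M = 0`, e.g. a det-root of a pencil): `(uᵀMu)·(u⊥ᵀMu⊥) = (u⊥ᵀMu)² ≥ 0`. [folklore] -/
theorem quadForm_mul_perp_eq_mixed_sq_of_det_eq_zero (M : Matrix (Fin 2) (Fin 2) ℝ) (hM : M.IsSymm) (hdet : M.det = 0)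
    (u : Fin 2 → ℝ) : (u ⬝ᵥ (M *ᵥ u)) * (![-u 1, u 0] ⬝ᵥ (M *ᵥ ![-u 1, u 0])) = (![-u 1, u 0] ⬝ᵥ (M *ᵥ u)) ^ 2 := by
  have h := quadForm_mul_perp_sub_mixed_sq M hM u
  rw [hdet, mul_zero] at h
  linarith

/-- At a definite point (`det M > 0`): `(uᵀMu)·(u⊥ᵀMu⊥) ≥ (u⊥ᵀMu)²`, in particular the two orthogonal directions have the same
(weak) sign. [folklore] -/
theorem mixed_sq_le_quadForm_mul_perp_of_det_pos (M : Matrix (Fin 2) (Fin 2) ℝ) (hM : M.IsSymm) (hdet : 0 < M.det)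
    (u : Fin 2 → ℝ) : (![-u 1, u 0] ⬝ᵥ (M *ᵥ u)) ^ 2 ≤ (u ⬝ᵥ (M *ᵥ u)) * (![-u 1, u 0] ⬝ᵥ (M *ᵥ ![-u 1, u 0])) := by
  have h := quadForm_mul_perp_sub_mixed_sq M hM u
  nlinarith [sq_nonneg (u ⬝ᵥ u)]

/-- The mixed form vanishes iff `u` is an eigenvector: `u⊥ᵀ M u = 0 ↔ M u ∥ u` (for `u ≠ 0` the eigenvalue is `uᵀMu / |u|²`).  Stated as
the identity `|u|²·Mu = (uᵀMu)·u + (u⊥ᵀMu)·u⊥` (expansion of `Mu` in the orthogonal pair). [folklore] -/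
theorem mulVec_eq_quadForm_smul_add_mixed_smul (M : Matrix (Fin 2) (Fin 2) ℝ) (u : Fin 2 → ℝ) :
    (u ⬝ᵥ u) • (M *ᵥ u) = (u ⬝ᵥ (M *ᵥ u)) • u + (![-u 1, u 0] ⬝ᵥ (M *ᵥ u)) • ![-u 1, u 0] := by
  funext i
  simp only [Pi.add_apply, Pi.smul_apply, smul_eq_mul, dotProduct_mulVec_fin_two]
  simp only [dotProduct, Fin.sum_univ_two, Matrix.mulVec, Matrix.cons_val_zero, Matrix.cons_val_one]
  fin_cases i <;> simp <;> ring

/-- **DISCRETE SWEEP LEMMA (the real, rank-3 ingredient).**  If a real symmetric `2 × 2` matrix is INDEFINITE (`det M < 0`) and `u ≠ 0` is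
an eigenvector (`u⊥ᵀMu = 0`), then `uᵀMu · u⊥ᵀMu⊥ < 0`: one of the two orthogonal directions is strictly negative, the other strictly
positive.  (False for complex-Hermitian matrices, where the mixed form is complex.) [folklore] -/
theorem quadForm_mul_perp_neg_of_mixed_eq_zero (M : Matrix (Fin 2) (Fin 2) ℝ) (hM : M.IsSymm) (hdet : M.det < 0)
    (u : Fin 2 → ℝ) (hu : u ≠ 0) (hg : ![-u 1, u 0] ⬝ᵥ (M *ᵥ u) = 0) :
    (u ⬝ᵥ (M *ᵥ u)) * (![-u 1, u 0] ⬝ᵥ (M *ᵥ ![-u 1, u 0])) < 0 := by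
  have h := quadForm_mul_perp_sub_mixed_sq M hM u
  rw [hg] at h
  have hu2 : 0 < u ⬝ᵥ u := by
    have : u ⬝ᵥ u ≠ 0 := fun h0 => hu (dotProduct_self_eq_zero.mp h0)
    exact lt_of_le_of_ne (by simp only [dotProduct, Fin.sum_univ_two]; nlinarith [sq_nonneg (u 0), sq_nonneg (u 1)]) this.symm
  have : (u ⬝ᵥ (M *ᵥ u)) * (![-u 1, u 0] ⬝ᵥ (M *ᵥ ![-u 1, u 0])) = (u ⬝ᵥ u) ^ 2 * M.det := by linarith
  rw [this]
  exact mul_neg_of_pos_of_neg (by positivity) hdet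

/-! ### Bilinear values of the pencil are six-nomials -/

/-- The bilinear value of the evaluated pencil is the `K`-nomial `∑ x^(d l) · vᵀ S_l u`. [folklore] -/
theorem bilinForm_pencil_eval {K : ℕ} (d : Fin K → ℕ) (S : Fin K → Matrix (Fin 2) (Fin 2) ℝ) (v u : Fin 2 → ℝ) (x : ℝ) :
    v ⬝ᵥ ((∑ l, x ^ d l • S l) *ᵥ u) = ∑ l, x ^ d l * (v ⬝ᵥ (S l *ᵥ u)) := by
  rw [Matrix.sum_mulVec, dotProduct_sum]
  exact Finset.sum_congr rfl fun l _ => by rw [Matrix.smul_mulVec, dotProduct_smul, smul_eq_mul]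

/-- The bilinear value `x ↦ vᵀF(x)u` as the determinant of a `1 × 1` lacunary pencil, evaluated. [folklore] -/
theorem eval_bilinForm_pencil_one {K : ℕ} (d : Fin K → ℕ) (S : Fin K → Matrix (Fin 2) (Fin 2) ℝ) (v u : Fin 2 → ℝ) (x : ℝ) :
    (Matrix.det (∑ l, ((X : ℝ[X]) ^ d l) • (!![v ⬝ᵥ (S l *ᵥ u)] : Matrix (Fin 1) (Fin 1) ℝ).map C)).eval x
      = v ⬝ᵥ ((∑ l, x ^ d l • S l) *ᵥ u) := by
  rw [eval_det_pencil_one, bilinForm_pencil_eval]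

/-! ### Flips of a bilinear value along the twenty roots -/

/-- **Any bilinear value flips at most five times along the roots of a twenty** (any support; symmetry not needed for this count).
For a six-term `2 × 2` pencil with `20` sorted distinct positive det-roots `r 0 < ⋯ < r 19` and ANY two vectors `v, u`, the number of
consecutive pairs with `vᵀF(r k)u · vᵀF(r (k+1))u < 0` is at most `5`: each flip puts a root of the six-nomial `x ↦ vᵀF(x)u` in the
open gap, and a non-zero six-nomial has fewer than `6` positive roots.  With `v = u⊥` (mixed form) this is the EIGENFRAME BUDGET: the
kernel directions at the roots, read through the quadrant test of the cross `(u, u⊥)` and twisted by the types `sign tr F(r k)`, change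
at most five times. [folklore] -/
theorem card_bilinFlips_le_five_of_twenty (d : Fin 6 → ℕ) (S : Fin 6 → Matrix (Fin 2) (Fin 2) ℝ)
    (r : Fin 20 → ℝ) (hr : StrictMono r) (hr0 : ∀ k, 0 < r k) (v u : Fin 2 → ℝ) :
    (Finset.univ.filter (fun k : Fin 19 =>
        (v ⬝ᵥ ((∑ l, r k.castSucc ^ d l • S l) *ᵥ u)) * (v ⬝ᵥ ((∑ l, r k.succ ^ d l • S l) *ᵥ u)) < 0)).card ≤ 5 := by
  classical
  obtain ⟨Fl, hFl⟩ : ∃ Fl : Finset (Fin 19), Fl = Finset.univ.filter (fun k : Fin 19 =>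
        (v ⬝ᵥ ((∑ l, r k.castSucc ^ d l • S l) *ᵥ u)) * (v ⬝ᵥ ((∑ l, r k.succ ^ d l • S l) *ᵥ u)) < 0) := ⟨_, rfl⟩
  rw [← hFl]
  obtain ⟨ψ, hψdef⟩ : ∃ ψ : ℝ[X],
      ψ = Matrix.det (∑ l, ((X : ℝ[X]) ^ d l) • (!![v ⬝ᵥ (S l *ᵥ u)] : Matrix (Fin 1) (Fin 1) ℝ).map C) := ⟨_, rfl⟩
  have hψ : ∀ x, ψ.eval x = v ⬝ᵥ ((∑ l, x ^ d l • S l) *ᵥ u) := fun x => by rw [hψdef, eval_bilinForm_pencil_one]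
  by_cases hFl0 : Fl = ∅
  · rw [hFl0]; simp
  -- the six-nomial is not the zero polynomial (it takes a non-zero value at a flip)
  obtain ⟨k0, hk0⟩ := Finset.nonempty_iff_ne_empty.mpr hFl0
  have hψne : Matrix.det (∑ l, ((X : ℝ[X]) ^ d l) • (!![v ⬝ᵥ (S l *ᵥ u)] : Matrix (Fin 1) (Fin 1) ℝ).map C) ≠ 0 := by
    intro h0
    rw [hFl, Finset.mem_filter] at hk0
    have := hk0.2
    rw [← hψ, ← hψ, hψdef, h0, eval_zero, zero_mul] at this
    exact lt_irrefl _ this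
  -- the flip gaps as a separated family of sign changes of `ψ`
  have hfam : ∀ q ∈ Fl.image (fun k : Fin 19 => (r k.castSucc, r k.succ)),
      0 < q.1 ∧ q.1 < q.2 ∧ ψ.eval q.1 * ψ.eval q.2 < 0 := by
    intro q hq
    obtain ⟨k, hk, rfl⟩ := Finset.mem_image.mp hq
    refine ⟨hr0 _, hr (show k.castSucc < k.succ from Fin.castSucc_lt_succ), ?_⟩
    rw [hFl, Finset.mem_filter] at hk
    dsimp only
    rw [hψ, hψ]
    exact hk.2
  have hsep : ∀ q ∈ Fl.image (fun k : Fin 19 => (r k.castSucc, r k.succ)),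
      ∀ q' ∈ Fl.image (fun k : Fin 19 => (r k.castSucc, r k.succ)), q ≠ q' → q.2 ≤ q'.1 ∨ q'.2 ≤ q.1 := by
    intro q hq q' hq' hne
    obtain ⟨k, _, rfl⟩ := Finset.mem_image.mp hq
    obtain ⟨k', _, rfl⟩ := Finset.mem_image.mp hq'
    have hkk : k ≠ k' := fun h => hne (by rw [h])
    rcases lt_or_gt_of_ne hkk with hlt | hlt
    · left
      show r k.succ ≤ r k'.castSucc
      have hlt' := Fin.lt_def.mp hlt
      exact hr.monotone (by rw [Fin.le_iff_val_le_val, Fin.val_succ, Fin.val_castSucc]; omega)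
    · right
      show r k'.succ ≤ r k.castSucc
      have hlt' := Fin.lt_def.mp hlt
      exact hr.monotone (by rw [Fin.le_iff_val_le_val, Fin.val_succ, Fin.val_castSucc]; omega)
  have hcard : (Fl.image (fun k : Fin 19 => (r k.castSucc, r k.succ))).card = Fl.card := by
    apply Finset.card_image_of_injOn
    intro k _ k' _ h
    have h1 : r k.castSucc = r k'.castSucc := congrArg Prod.fst h
    exact Fin.castSucc_injective _ (hr.injective h1)
  have h1 := card_le_card_posRoots_of_signChanges ψ _ hfam hsep
  have h2 := card_posRoots_nomial_lt d (fun l => v ⬝ᵥ (S l *ᵥ u)) hψne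
  rw [← hψdef] at h2
  rw [hcard] at h1
  omega


/-! ### A counting lemma: flip gaps and split dip gaps of one polynomial -/

/-- Sign bookkeeping: from `0 < a·b` and `a < 0` conclude `b < 0`. [folklore] -/
theorem neg_of_mul_pos_of_neg' {a b : ℝ} (h : 0 < a * b) (ha : a < 0) : b < 0 := by
  rcases lt_trichotomy b 0 with hb | hb | hb
  · exact hb
  · rw [hb, mul_zero] at h; exact absurd h (lt_irrefl 0)
  · have := mul_neg_of_neg_of_pos ha hb; linarith

/-- **Counting lemma.**  Along sorted positive points `r 0 < ⋯ < r 19`, let a polynomial `φ` change sign across the gaps `k ∈ A`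
(`φ(r k)·φ(r (k+1)) < 0`) and, on the gaps `k ∈ B` (disjoint from `A`), change sign TWICE through an interior point `x₀ k`
(`φ(r k)·φ(x₀ k) < 0`, `φ(x₀ k)·φ(r (k+1)) < 0`).  Then `#A + 2·#B ≤ #{positive roots of φ}`. [folklore] -/
theorem card_add_two_mul_card_le_card_posRoots (φ : ℝ[X]) (r : Fin 20 → ℝ) (hr : StrictMono r) (hr0 : ∀ k, 0 < r k)
    (x₀ : Fin 19 → ℝ) (A B : Finset (Fin 19)) (hAB : Disjoint A B)
    (hA : ∀ k ∈ A, φ.eval (r k.castSucc) * φ.eval (r k.succ) < 0)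
    (hB0 : ∀ k ∈ B, r k.castSucc < x₀ k ∧ x₀ k < r k.succ)
    (hB1 : ∀ k ∈ B, φ.eval (r k.castSucc) * φ.eval (x₀ k) < 0)
    (hB2 : ∀ k ∈ B, φ.eval (x₀ k) * φ.eval (r k.succ) < 0) :
    A.card + 2 * B.card ≤ (φ.roots.toFinset.filter (fun t => 0 < t)).card := by
  classical
  -- the three families of intervals
  set f0 : Fin 19 → ℝ × ℝ := fun k => (r k.castSucc, r k.succ) with hf0
  set f1 : Fin 19 → ℝ × ℝ := fun k => (r k.castSucc, x₀ k) with hf1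
  set f2 : Fin 19 → ℝ × ℝ := fun k => (x₀ k, r k.succ) with hf2
  have hgap : ∀ k : Fin 19, r k.castSucc < r k.succ := fun k => hr (show k.castSucc < k.succ from Fin.castSucc_lt_succ)
  have hsep_gap : ∀ k k' : Fin 19, k < k' → r k.succ ≤ r k'.castSucc := by
    intro k k' hlt
    have hlt' := Fin.lt_def.mp hlt
    exact hr.monotone (by rw [Fin.le_iff_val_le_val, Fin.val_succ, Fin.val_castSucc]; omega)
  have hcs_inj : ∀ k k' : Fin 19, r k.castSucc = r k'.castSucc → k = k' :=
    fun k k' h => Fin.castSucc_injective _ (hr.injective h)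
  have hs_inj : ∀ k k' : Fin 19, r k.succ = r k'.succ → k = k' :=
    fun k k' h => Fin.succ_injective _ (hr.injective h)
  -- every interval of gap `k` lies in `[r k, r (k+1)]`
  set I : Finset (ℝ × ℝ) := A.image f0 ∪ (B.image f1 ∪ B.image f2) with hI
  have hmemI : ∀ q ∈ I, ∃ k : Fin 19, r k.castSucc ≤ q.1 ∧ q.2 ≤ r k.succ ∧
      ((k ∈ A ∧ q = f0 k) ∨ (k ∈ B ∧ q = f1 k) ∨ (k ∈ B ∧ q = f2 k)) := by
    intro q hq
    rw [hI, Finset.mem_union, Finset.mem_union, Finset.mem_image, Finset.mem_image, Finset.mem_image] at hq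
    rcases hq with ⟨k, hk, rfl⟩ | ⟨k, hk, rfl⟩ | ⟨k, hk, rfl⟩
    · exact ⟨k, le_refl _, le_refl _, Or.inl ⟨hk, rfl⟩⟩
    · exact ⟨k, le_refl _, (hB0 k hk).2.le, Or.inr (Or.inl ⟨hk, rfl⟩)⟩
    · exact ⟨k, (hB0 k hk).1.le, le_refl _, Or.inr (Or.inr ⟨hk, rfl⟩)⟩
  -- sign changes on every interval
  have hsign : ∀ q ∈ I, 0 < q.1 ∧ q.1 < q.2 ∧ φ.eval q.1 * φ.eval q.2 < 0 := by
    intro q hq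
    obtain ⟨k, _, _, hk⟩ := hmemI q hq
    rcases hk with ⟨hk, rfl⟩ | ⟨hk, rfl⟩ | ⟨hk, rfl⟩
    · exact ⟨hr0 _, hgap k, hA k hk⟩
    · exact ⟨hr0 _, (hB0 k hk).1, hB1 k hk⟩
    · exact ⟨lt_trans (hr0 _) (hB0 k hk).1, (hB0 k hk).2, hB2 k hk⟩
  -- separation
  have hsep : ∀ q ∈ I, ∀ q' ∈ I, q ≠ q' → q.2 ≤ q'.1 ∨ q'.2 ≤ q.1 := by
    intro q hq q' hq' hne
    obtain ⟨k, hk1, hk2, hk⟩ := hmemI q hq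
    obtain ⟨k', hk1', hk2', hk'⟩ := hmemI q' hq'
    by_cases hkk : k = k'
    · subst hkk
      -- same gap: only the two halves `f1 k`, `f2 k` can differ
      have hnotAB : ¬ (k ∈ A ∧ k ∈ B) := fun h => Finset.disjoint_left.mp hAB h.1 h.2
      rcases hk with ⟨hkA, rfl⟩ | ⟨hkB, rfl⟩ | ⟨hkB, rfl⟩ <;>
        rcases hk' with ⟨hkA', rfl⟩ | ⟨hkB', rfl⟩ | ⟨hkB', rfl⟩
      · exact absurd rfl hne
      · exact absurd ⟨hkA, hkB'⟩ hnotAB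
      · exact absurd ⟨hkA, hkB'⟩ hnotAB
      · exact absurd ⟨hkA', hkB⟩ hnotAB
      · exact absurd rfl hne
      · left; exact le_refl _
      · exact absurd ⟨hkA', hkB⟩ hnotAB
      · right; exact le_refl _
      · exact absurd rfl hne
    · rcases lt_or_gt_of_ne hkk with hlt | hlt
      · left; exact hk2.trans ((hsep_gap k k' hlt).trans hk1')
      · right; exact hk2'.trans ((hsep_gap k' k hlt).trans hk1)
  -- cardinality of the family
  have hinj0 : Set.InjOn f0 A := fun k _ k' _ h => hcs_inj k k' (congrArg Prod.fst h)
  have hinj1 : Set.InjOn f1 B := fun k _ k' _ h => hcs_inj k k' (congrArg Prod.fst h)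
  have hinj2 : Set.InjOn f2 B := fun k _ k' _ h => hs_inj k k' (congrArg Prod.snd h)
  have hd12 : Disjoint (B.image f1) (B.image f2) := by
    rw [Finset.disjoint_left]
    intro q hq1 hq2
    obtain ⟨k, hk, rfl⟩ := Finset.mem_image.mp hq1
    obtain ⟨k', hk', h⟩ := Finset.mem_image.mp hq2
    have h1 : x₀ k' = r k.castSucc := congrArg Prod.fst h
    have h2 : r k'.succ = x₀ k := congrArg Prod.snd h
    -- `r k' < x₀ k' = r k` gives `k' < k`, then `r (k'+1) ≤ r k < x₀ k = r (k'+1)`: absurd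
    have hlt : k' < k := by
      have : r k'.castSucc < r k.castSucc := by rw [← h1]; exact (hB0 k' hk').1
      exact Fin.castSucc_lt_castSucc_iff.mp (hr.lt_iff_lt.mp this)
    have := hsep_gap k' k hlt
    have h3 := (hB0 k hk).1
    rw [← h2] at h3
    exact absurd h3 (not_lt.mpr this)
  have hd0 : Disjoint (A.image f0) (B.image f1 ∪ B.image f2) := by
    rw [Finset.disjoint_left]
    intro q hq0 hq
    obtain ⟨k, hk, rfl⟩ := Finset.mem_image.mp hq0
    rw [Finset.mem_union, Finset.mem_image, Finset.mem_image] at hq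
    rcases hq with ⟨k', hk', h⟩ | ⟨k', hk', h⟩
    · have h1 : r k'.castSucc = r k.castSucc := congrArg Prod.fst h
      have hkk := hcs_inj k' k h1
      subst hkk
      have h2 : x₀ k' = r k'.succ := congrArg Prod.snd h
      exact absurd h2 (ne_of_lt (hB0 k' hk').2)
    · have h2 : r k'.succ = r k.succ := congrArg Prod.snd h
      have hkk := hs_inj k' k h2
      subst hkk
      have h1 : x₀ k' = r k'.castSucc := congrArg Prod.fst h
      exact absurd h1 (ne_of_gt (hB0 k' hk').1)
  have hIcard : I.card = A.card + 2 * B.card := by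
    rw [hI, Finset.card_union_of_disjoint hd0, Finset.card_union_of_disjoint hd12,
      Finset.card_image_of_injOn hinj0, Finset.card_image_of_injOn hinj1, Finset.card_image_of_injOn hinj2]
    ring
  have h := card_le_card_posRoots_of_signChanges φ I hsign hsep
  rw [hIcard] at h
  exact h


end Summit.ValiantsHypothesis.ValiantsHypothesis.Theorems.LacunarySymmetroidMatrixDescartes.Census
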